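import Literature.NumberTheory.Automorphic.TwistedAsaiPole
import Literature.NumberTheory.Automorphic.AsaiSignArchParityTwist
import HarnessLib

/-!
# Stub `stub_twistedFactors` (W4) of line `Sketch` — the untwisted local Asai factors of the twisted
# family are the twisted factors of the family (crux `ParityBlindBianchi.QuadraticDescentGL2`, stmt-Langlands-16811)

Skeleton v3 of the line `Sketch` derives Flicker's `χ`-twisted `GL₂` Asai continuation from the untwisted
tree fact applied to the twist `P ⊗ μ`, `μ` a Hecke character of `E` restricting to `χ` on the ideles of
`F`.  This file proves the registered stub `stub_twistedFactors`, the factor-by-factor identity behind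
Flicker's device "replace `π` by its product with a character" (1988, p. 296): for `E/F` quadratic with
involution `c ≠ 1`, an Asai datum `(S, A)` of a cuspidal `P` on `GL₂(𝔸_E)`, a Hecke character `μ` of `E`
with `μ|_{𝕀_F} = χ` unramified above the complement of `S`, every sign `θ` and every `v ∉ S` with chosen
place `w = placeAbove E v`,

`(asaiLocalPolynomial c (w ↦ μ(ϖ_w) • A w) θ w)(x) = (asaiLocalPolynomial c A θ w)(χ(ϖ_v) x)`.

Proof (all inputs are theorems of the tree): twisting the Satake family by `t_w = μ(ϖ_w)` composes the
local Asai polynomial with `X ↦ t_w X` at a `c`-fixed `w` and with `X ↦ t_w t_{c • w} X` at a `c`-moved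
one (`asaiLocalPolynomial_twist_of_smul_eq` / `_of_smul_ne`, file `TwistedAsaiPole`); above `v ∉ S`
every place is unramified over `F` (`HeightOneSpectrum.ramificationIdx_eq_one_of_asai`, from the Asai
datum's `f(w|v) = 2` at `c`-fixed places), so the restriction formulas
`HeckeCharacter.valueAtUniformizer_restrict_of_smul_eq` / `_of_smul_ne` (file `AsaiSignArchParityTwist`)
give `χ(ϖ_v) = μ(ϖ_w)` at an inert and `χ(ϖ_v) = μ(ϖ_w) μ(ϖ_{c • w})` at a split `v`
(`(c • w) ∩ 𝓞 F = w ∩ 𝓞 F`, `HeightOneSpectrum.under_algEquiv_smul`, makes `μ` unramified at `c • w` too).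
-/

set_option linter.dupNamespace false -- `Summit.Langlands.Langlands` is the mandated namespace (lakefile weak option)

noncomputable section

open scoped Classical
open NumberField IsDedekindDomain Polynomial Filter
open Literature.NumberTheory.Automorphic Literature.NumberTheory.GaloisRepresentations

namespace Summit.Langlands.Langlands.Theorems.QuadraticDescentGL2.Sketch

/-- **Stub W4 (untwisted local Asai factors of the twisted family = twisted factors of the family).**
For `E/F` quadratic with involution `c ≠ 1`, a cuspidal `P` on `GL₂(𝔸_E)` with Asai datum `(S, A)`, a
Hecke character `μ` of `E` over the Hecke character `χ` of `F` (`μ|_{𝕀_F} = χ`) unramified above the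
complement of `S`, every sign `θ`, every `v ∉ S` and every `x : ℂ`: the local Asai polynomial at
`w_v = placeAbove E v` of the twisted family `w ↦ μ(ϖ_w) • A w`, evaluated at `x`, is the local Asai
polynomial of `A` at `w_v` evaluated at `χ(ϖ_v) x` — Flicker's "we can replace `π` by its product with an
unramified character" on the local factors of the partial twisted tensor Euler product.
[cite: Flicker1988, p. 296] -/
theorem stub_twistedFactors :
    ∀ (F E : Type) [Field F] [NumberField F] [Field E] [NumberField E] [Algebra F E] (c : E ≃ₐ[F] E),
      Module.finrank F E = 2 → c ≠ 1 →
      ∀ (hE : isCompact_glFiniteIntegralLevel 2 E) (P : CuspidalAutomorphicRepData 2 E hE)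
        (μ : HeckeCharacter E) (χ : HeckeCharacter F) (S : Set (HeightOneSpectrum (𝓞 F))) (A : SatakeFamily E),
        P.1.IsAsaiDatum c S A →
        (∀ x, μ (AdeleRing.ideleBaseChange F E x) = χ x) →
        (∀ w : HeightOneSpectrum (𝓞 E), w.under (𝓞 F) ∉ S → μ.IsUnramifiedAt w) →
        ∀ (θ : ℤˣ) (v : HeightOneSpectrum (𝓞 F)), v ∉ S → ∀ x : ℂ,
          (asaiLocalPolynomial c (fun w => (A w).map (μ.valueAtUniformizer w * ·)) θ (placeAbove E v)).eval x =
            (asaiLocalPolynomial c A θ (placeAbove E v)).eval (χ.valueAtUniformizer v * x) := by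
  intro F E _ _ _ _ _ c h2 hc hE P μ χ S A hA hres hunr θ v hv x
  -- the chosen place `w = placeAbove E v` lies above `v ∉ S`
  have hvw : (placeAbove E v).under (𝓞 F) ∉ S := by rw [placeAbove_under]; exact hv
  -- above `v ∉ S` every place is unramified over `F` (the `c`-fixed ones have `f = 2`)
  have he : (placeAbove E v).asIdeal.ramificationIdx (𝓞 F) = 1 :=
    HeightOneSpectrum.ramificationIdx_eq_one_of_asai h2 (hA.inertiaDeg_eq_two hvw)
  have hμ : μ.IsUnramifiedAt (placeAbove E v) := hunr _ hvw
  by_cases hcw : c • placeAbove E v = placeAbove E v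
  · -- inert: `χ(ϖ_v) = μ(ϖ_w)` and the twist is the substitution `X ↦ μ(ϖ_w) X`
    have hval : χ.valueAtUniformizer v = μ.valueAtUniformizer (placeAbove E v) := by
      have h := HeckeCharacter.valueAtUniformizer_restrict_of_smul_eq h2 hc hres hcw he hμ
      rwa [placeAbove_under] at h
    rw [asaiLocalPolynomial_twist_of_smul_eq A μ.valueAtUniformizer θ hcw, eval_comp, eval_mul, eval_C,
      eval_X, hval]
  · -- split: `μ` is unramified at `c • w` too, `χ(ϖ_v) = μ(ϖ_w) μ(ϖ_{c • w})`, and the twist is the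
    -- substitution `X ↦ μ(ϖ_w) μ(ϖ_{c • w}) X`
    have hμc : μ.IsUnramifiedAt (c • placeAbove E v) :=
      hunr _ (by rw [HeightOneSpectrum.under_algEquiv_smul F E c (placeAbove E v)]; exact hvw)
    have hval : χ.valueAtUniformizer v =
        μ.valueAtUniformizer (placeAbove E v) * μ.valueAtUniformizer (c • placeAbove E v) := by
      have h := HeckeCharacter.valueAtUniformizer_restrict_of_smul_ne h2 hc hres hcw he hμ hμc
      rwa [placeAbove_under] at h
    rw [asaiLocalPolynomial_twist_of_smul_ne A μ.valueAtUniformizer θ hcw, eval_comp, eval_mul, eval_C,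
      eval_X, hval]

end Summit.Langlands.Langlands.Theorems.QuadraticDescentGL2.Sketch

end
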